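import Summits.RiemannHypothesis.RiemannHypothesis.Theorems.PfPersistenceGalerkinCutoffProfile
import Literature.Analysis.Fourier.ErdosTuranDiscrepancy
import HarnessLib

/-!
# Fejér means of an even test are cut-off Connes profiles (GAL-1 density, approximation half)

**mechanism/rigidity campaign; no RH claims.** Approximation half of the typed density input
`TestToClosedFormDensity` (GAL-1 (ii‴), `PfPersistenceGalerkinDensityTransfer`): a smooth even real test
`g` with `tsupport g ⊆ [-a, a]` is approximated by CUT-OFF CONNES PROFILES
`cutoffProfile (a, N) v = 𝟙_{[-a,a]} · Σ_{n ≤ N} v_n ξ_n` UNIFORMLY, with a Lipschitz bound on the error that is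
UNIFORM IN `N`; this file supplies the three Fejér facts (a)–(c) below, assembled in
`PfPersistenceGalerkinTestDensity` (`exists_cutoffProfile_near`, `testToClosedFormDensity`).

Construction (Fejér). Let `G` be the even `2a`-periodisation of `g|[-a,a]`
(`periodize a gr x = gr (dist(x, 2aℤ))`, the distance realised as the quotient norm of `AddCircle (2a)`; it is
`Lip(g)`-Lipschitz because the fold is `1`-Lipschitz) and
`σ_M(x) = (1/2π) ∫_{-π}^{π} G(x − (a/π)u) F_{M+1}(u) du` its Fejér mean (`fejerMean`; `F_{M+1}` = the tree's
`Literature.Probability.LatticeModels.fejerKernel (M+1)`). POSITIVITY and UNIT MASS of the Fejér kernel give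
(a) `|σ_M(x) − G(x)| ≤ Lip(G)(a/π)δ + 2 sup|G| π²/(δ²(M+1))` for every `δ > 0` (`abs_fejerMean_sub_le`, using the
pointwise bound `u² F_{M+1}(u) ≤ π²/(M+1)`, `fejerKernel_le_div_sq`) and (b) `Lip(σ_M) ≤ Lip(G)`
(`abs_fejerMean_sub_fejerMean_le`); the double-cosine expansion `F_{M+1}(u) = Σ_{k,l ≤ M} cos((k−l)u)/(M+1)`
(`fejerKernel_eq_double_sum_cos`), the substitution `s = x − (a/π)u`, `2a`-periodicity and the evenness of `g`
(the sine moments vanish) give (c) `σ_M = profile (2a) (fejerVec a gr M)` ON ALL OF `ℝ`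
(`fejerMean_eq_profile`), so `𝟙_{[-a,a]} σ_M` is a cut-off profile.

References: Fejér's theorem for Lipschitz periodic functions [folklore]; H. L. Montgomery, *Ten lectures*, CBMS 84
(1994), Ch. 1 §2 (Fejér kernel: positivity, mass, tail); the kernel facts used are the tree's
(`Literature.Analysis.Fourier.integral_fejerKernel`, `fejerKernel_eq_double_sum_cos`, `fejerKernel_le_div_sq`).
-/

noncomputable section

open Set MeasureTheory Filter Real Finset
open scoped Topology
open Literature.NumberTheory.LFunctions
open Literature.Probability.LatticeModels (fejerKernel fejerKernel_nonneg fejerKernel_le_div_sq)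
open Literature.Analysis.Fourier (fejerKernel_eq_double_sum_cos continuous_fejerKernel integral_fejerKernel)

set_option linter.dupNamespace false

namespace Summit.RiemannHypothesis.RiemannHypothesis.Theorems.PfPersistence

namespace FejerProfile

/-! ## 1. The fold `x ↦ dist(x, 2aℤ)` and the even periodisation -/

/-- The distance from `x` to `2aℤ`, realised as the quotient norm of `x` in `AddCircle (2a)` (the even
`2a`-periodic triangle wave, `= |x|` on `[-a, a]`). [folklore] -/
def foldAbs (a x : ℝ) : ℝ := ‖((x : ℝ) : AddCircle (2 * a))‖

/-- `dist(x, 2aℤ) ≤ a`. [folklore] -/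
theorem foldAbs_le {a : ℝ} (ha : 0 < a) (x : ℝ) : foldAbs a x ≤ a := by
  have h := AddCircle.norm_le_half_period (2 * a) (x := ((x : ℝ) : AddCircle (2 * a)))
    (by positivity : (2 * a) ≠ 0)
  rw [abs_of_pos (by positivity : (0 : ℝ) < 2 * a)] at h
  unfold foldAbs
  linarith

/-- `dist(x, 2aℤ) = |x|` on `[-a, a]`. [folklore] -/
theorem foldAbs_eq_abs {a x : ℝ} (ha : 0 < a) (hx : x ∈ Icc (-a) a) : foldAbs a x = |x| := by
  unfold foldAbs
  rw [AddCircle.norm_coe_eq_abs_iff (2 * a) (by positivity : (2 * a) ≠ 0),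
    abs_of_pos (by positivity : (0 : ℝ) < 2 * a), abs_le]
  constructor <;> linarith [hx.1, hx.2]

/-- the fold is `2a`-periodic. [folklore] -/
theorem foldAbs_add_period (a x : ℝ) : foldAbs a (x + 2 * a) = foldAbs a x := by
  unfold foldAbs
  rw [AddCircle.coe_add_period]

/-- the fold is `1`-Lipschitz (quotient norms are `1`-Lipschitz). [folklore] -/
theorem abs_foldAbs_sub_le (a x y : ℝ) : |foldAbs a x - foldAbs a y| ≤ |x - y| := by
  unfold foldAbs
  calc |‖((x : ℝ) : AddCircle (2 * a))‖ - ‖((y : ℝ) : AddCircle (2 * a))‖|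
      ≤ ‖((x : ℝ) : AddCircle (2 * a)) - ((y : ℝ) : AddCircle (2 * a))‖ := abs_norm_sub_norm_le _ _
    _ = ‖(((x - y : ℝ)) : AddCircle (2 * a))‖ := by rw [AddCircle.coe_sub]
    _ ≤ |x - y| := (QuotientAddGroup.norm_mk_le_norm).trans_eq (Real.norm_eq_abs _)

/-- The EVEN `2a`-PERIODISATION `x ↦ gr(dist(x, 2aℤ))` of (the restriction to `[-a, a]` of) an even function
`gr`. [folklore] -/
def periodize (a : ℝ) (gr : ℝ → ℝ) (x : ℝ) : ℝ := gr (foldAbs a x)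

variable {a : ℝ} {gr G : ℝ → ℝ} {K S : ℝ}

/-- the periodisation of an even function agrees with it on `[-a, a]`. [folklore] -/
theorem periodize_eq (ha : 0 < a) (hev : ∀ s, gr (-s) = gr s) {x : ℝ} (hx : x ∈ Icc (-a) a) :
    periodize a gr x = gr x := by
  unfold periodize
  rw [foldAbs_eq_abs ha hx]
  rcases le_or_gt 0 x with h | h
  · rw [abs_of_nonneg h]
  · rw [abs_of_neg h, hev]

/-- the periodisation is `2a`-periodic. [folklore] -/
theorem periodize_periodic (a : ℝ) (gr : ℝ → ℝ) : Function.Periodic (periodize a gr) (2 * a) :=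
  fun x ↦ by unfold periodize; rw [foldAbs_add_period]

/-- the periodisation of a `K`-Lipschitz function is `K`-Lipschitz. [folklore] -/
theorem abs_periodize_sub_le (hK0 : 0 ≤ K) (hK : ∀ x y, |gr x - gr y| ≤ K * |x - y|) (x y : ℝ) :
    |periodize a gr x - periodize a gr y| ≤ K * |x - y| :=
  (hK _ _).trans (mul_le_mul_of_nonneg_left (abs_foldAbs_sub_le a x y) hK0)

/-- a real function with a Lipschitz bound is continuous. [folklore] -/
theorem continuous_of_abs_sub_le (hK : ∀ x y, |G x - G y| ≤ K * |x - y|) : Continuous G :=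
  (LipschitzWith.of_dist_le' fun x y ↦ by rw [Real.dist_eq, Real.dist_eq]; exact hK x y).continuous

/-! ## 2. Fejér means: deviation and Lipschitz bounds (positivity + unit mass) -/

/-- The FEJÉR MEAN `σ_M(x) = (1/2π) ∫_{-π}^{π} G(x − (a/π)u) F_{M+1}(u) du` of a `2a`-periodic `G`
(`F_{M+1} = |Σ_{k ≤ M} e^{iku}|²/(M+1)`, the tree's `fejerKernel (M+1)`). [folklore] -/
def fejerMean (a : ℝ) (G : ℝ → ℝ) (M : ℕ) (x : ℝ) : ℝ :=
  1 / (2 * π) * ∫ u in (-π)..π, G (x - a / π * u) * fejerKernel (M + 1) u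

/-- `u² F_{M+1}(u) ≤ π²/(M+1)` on `[-π, π]` (from `F_L(u) ≤ π²/(L u²)`). [folklore] -/
theorem sq_mul_fejerKernel_le (M : ℕ) {u : ℝ} (hu : u ∈ Icc (-π) π) :
    u ^ 2 * fejerKernel (M + 1) u ≤ π ^ 2 / (M + 1) := by
  rcases eq_or_ne u 0 with rfl | hu0
  · simp only [ne_eq, OfNat.ofNat_ne_zero, not_false_eq_true, zero_pow, zero_mul]; positivity
  · have hle : |u| ≤ π := abs_le.2 ⟨hu.1, hu.2⟩
    have h := fejerKernel_le_div_sq (L := M + 1) (by omega) hu0 hle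
    push_cast at h
    have hu2 : 0 < u ^ 2 := by positivity
    calc u ^ 2 * fejerKernel (M + 1) u ≤ u ^ 2 * (π ^ 2 / ((M + 1) * u ^ 2)) :=
          mul_le_mul_of_nonneg_left h hu2.le
      _ = π ^ 2 / (M + 1) := by field_simp

/-- integrability of the Fejér integrand. [folklore] -/
theorem intervalIntegrable_shift_mul_fejerKernel (hGc : Continuous G) (a : ℝ) (M : ℕ) (x : ℝ) :
    IntervalIntegrable (fun u ↦ G (x - a / π * u) * fejerKernel (M + 1) u) volume (-π) π :=
  ((hGc.comp (by fun_prop)).mul (continuous_fejerKernel M)).intervalIntegrable _ _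

/-- positivity + unit mass: a pointwise bound `|φ| F ≤ c F + d` on `[-π, π]` integrates to
`|(1/2π) ∫ φ F| ≤ c + d`. [folklore] -/
theorem abs_weightedMean_le {φ : ℝ → ℝ} (hφ : Continuous φ) (M : ℕ) {c d : ℝ}
    (hptw : ∀ u ∈ Icc (-π) π, |φ u| * fejerKernel (M + 1) u ≤ c * fejerKernel (M + 1) u + d) :
    |1 / (2 * π) * ∫ u in (-π)..π, φ u * fejerKernel (M + 1) u| ≤ c + d := by
  have hπ := Real.pi_pos
  have hFc : Continuous (fejerKernel (M + 1)) := continuous_fejerKernel M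
  have hI : |∫ u in (-π)..π, φ u * fejerKernel (M + 1) u| ≤
      ∫ u in (-π)..π, (c * fejerKernel (M + 1) u + d) := by
    refine (intervalIntegral.abs_integral_le_integral_abs (by linarith)).trans ?_
    refine intervalIntegral.integral_mono_on (by linarith) ((hφ.mul hFc).abs.intervalIntegrable _ _)
      (((continuous_const.mul hFc).add continuous_const).intervalIntegrable (μ := volume) _ _) ?_
    intro u hu
    rw [abs_mul, abs_of_nonneg (fejerKernel_nonneg _ _)]
    exact hptw u hu
  have hi3 : IntervalIntegrable (fun u ↦ c * fejerKernel (M + 1) u) volume (-π) π :=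
    (continuous_const.mul hFc).intervalIntegrable _ _
  have hi4 : IntervalIntegrable (fun _ ↦ d) volume (-π) π := continuous_const.intervalIntegrable _ _
  rw [intervalIntegral.integral_add hi3 hi4, intervalIntegral.integral_const_mul,
    integral_fejerKernel, intervalIntegral.integral_const, smul_eq_mul] at hI
  rw [abs_mul, abs_of_pos (by positivity : (0 : ℝ) < 1 / (2 * π))]
  calc 1 / (2 * π) * |∫ u in (-π)..π, φ u * fejerKernel (M + 1) u|
      ≤ 1 / (2 * π) * (c * (2 * π) + (π - -π) * d) := by gcongr
    _ = c + d := by field_simp; ring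

/-- linearity: `σ_M[G](x) − σ_M[H](y) = (1/2π) ∫ (G(x − cu) − H(y − cu)) F`. [folklore] -/
theorem fejerMean_sub (hGc : Continuous G) {H : ℝ → ℝ} (hHc : Continuous H) (a : ℝ) (M : ℕ) (x y : ℝ) :
    fejerMean a G M x - fejerMean a H M y =
      1 / (2 * π) * ∫ u in (-π)..π, (G (x - a / π * u) - H (y - a / π * u)) * fejerKernel (M + 1) u := by
  unfold fejerMean
  rw [← mul_sub, ← intervalIntegral.integral_sub (intervalIntegrable_shift_mul_fejerKernel hGc a M x)
    (intervalIntegrable_shift_mul_fejerKernel hHc a M y)]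
  congr 1
  refine intervalIntegral.integral_congr fun u _ ↦ ?_
  ring

/-- the Fejér mean of a constant is the constant (unit mass). [folklore] -/
theorem fejerMean_const (a c : ℝ) (M : ℕ) (x : ℝ) : fejerMean a (fun _ ↦ c) M x = c := by
  unfold fejerMean
  rw [intervalIntegral.integral_const_mul, integral_fejerKernel]
  field_simp

/-- **Fejér deviation bound** (Lipschitz periodic data, positivity of the kernel): for every `δ > 0`,
`|σ_M(x) − G(x)| ≤ K(a/π)δ + 2Sπ²/(δ²(M+1))` where `K` bounds the Lipschitz constant and `S` the sup of `G`
(split `|G(x − cu) − G(x)| ≤ min(Kc|u|, 2S) ≤ Kcδ + 2S u²/δ²` and use `u²F ≤ π²/(M+1)`). [folklore] -/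
theorem abs_fejerMean_sub_le (ha : 0 < a) (hK0 : 0 ≤ K) (hK : ∀ x y, |G x - G y| ≤ K * |x - y|)
    (hS : ∀ x, |G x| ≤ S) (M : ℕ) {δ : ℝ} (hδ : 0 < δ) (x : ℝ) :
    |fejerMean a G M x - G x| ≤ K * (a / π) * δ + 2 * S * π ^ 2 / (δ ^ 2 * (M + 1)) := by
  have hπ := Real.pi_pos
  have hGc : Continuous G := continuous_of_abs_sub_le hK
  have hc0 : 0 < a / π := by positivity
  have hS0 : 0 ≤ S := (abs_nonneg _).trans (hS 0)
  have e : fejerMean a G M x - G x =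
      1 / (2 * π) * ∫ u in (-π)..π, (G (x - a / π * u) - G x) * fejerKernel (M + 1) u := by
    rw [← fejerMean_sub hGc continuous_const a M x x, fejerMean_const]
  rw [e]
  refine abs_weightedMean_le (φ := fun u ↦ G (x - a / π * u) - G x)
    ((hGc.comp (by fun_prop)).sub continuous_const) M fun u hu ↦ ?_
  have hF0 : 0 ≤ fejerKernel (M + 1) u := fejerKernel_nonneg _ _
  have hsq : u ^ 2 * fejerKernel (M + 1) u ≤ π ^ 2 / (M + 1) := sq_mul_fejerKernel_le M hu
  rcases le_or_gt |u| δ with hle | hlt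
  · have hG1 : |G (x - a / π * u) - G x| ≤ K * (a / π) * δ := by
      calc |G (x - a / π * u) - G x| ≤ K * |x - a / π * u - x| := hK _ _
        _ = K * (a / π * |u|) := by
            rw [show x - a / π * u - x = -(a / π * u) by ring, abs_neg, abs_mul, abs_of_pos hc0]
        _ ≤ K * (a / π * δ) := by gcongr
        _ = K * (a / π) * δ := by ring
    exact (mul_le_mul_of_nonneg_right hG1 hF0).trans (le_add_of_nonneg_right (by positivity))
  · have hG1 : |G (x - a / π * u) - G x| ≤ 2 * S := by
      calc |G (x - a / π * u) - G x| ≤ |G (x - a / π * u)| + |G x| := abs_sub _ _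
        _ ≤ S + S := add_le_add (hS _) (hS _)
        _ = 2 * S := by ring
    have hδu : δ ^ 2 ≤ u ^ 2 := by
      rw [← sq_abs u]; exact pow_le_pow_left₀ hδ.le hlt.le 2
    have hratio : 1 ≤ u ^ 2 / δ ^ 2 := by rw [le_div_iff₀ (by positivity), one_mul]; exact hδu
    calc |G (x - a / π * u) - G x| * fejerKernel (M + 1) u
        ≤ 2 * S * fejerKernel (M + 1) u := mul_le_mul_of_nonneg_right hG1 hF0
      _ ≤ 2 * S * fejerKernel (M + 1) u * (u ^ 2 / δ ^ 2) := le_mul_of_one_le_right (by positivity) hratio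
      _ = 2 * S / δ ^ 2 * (u ^ 2 * fejerKernel (M + 1) u) := by field_simp
      _ ≤ 2 * S / δ ^ 2 * (π ^ 2 / (M + 1)) := by gcongr
      _ = 2 * S * π ^ 2 / (δ ^ 2 * (M + 1)) := by field_simp
      _ ≤ K * (a / π) * δ * fejerKernel (M + 1) u + 2 * S * π ^ 2 / (δ ^ 2 * (M + 1)) :=
          le_add_of_nonneg_left (by positivity)

/-- **Fejér means inherit the Lipschitz constant**: `|σ_M(x) − σ_M(y)| ≤ K|x − y|` (positivity and unit mass of
the kernel). [folklore] -/
theorem abs_fejerMean_sub_fejerMean_le (hK : ∀ x y, |G x - G y| ≤ K * |x - y|) (a : ℝ) (M : ℕ) (x y : ℝ) :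
    |fejerMean a G M x - fejerMean a G M y| ≤ K * |x - y| := by
  have hGc : Continuous G := continuous_of_abs_sub_le hK
  rw [fejerMean_sub hGc hGc, ← add_zero (K * |x - y|)]
  refine abs_weightedMean_le (φ := fun u ↦ G (x - a / π * u) - G (y - a / π * u))
    ((hGc.comp (by fun_prop)).sub (hGc.comp (by fun_prop))) M fun u _ ↦ ?_
  rw [add_zero]
  refine mul_le_mul_of_nonneg_right ?_ (fejerKernel_nonneg _ _)
  calc |G (x - a / π * u) - G (y - a / π * u)| ≤ K * |x - a / π * u - (y - a / π * u)| := hK _ _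
    _ = K * |x - y| := by rw [show x - a / π * u - (y - a / π * u) = x - y by ring]

/-! ## 3. Fejér means of the even periodisation are Connes cosine profiles -/

/-- the cosine moments `A_n = ∫_{-a}^{a} gr(s) cos(nπs/a) ds`. [folklore] -/
def cosMoment (a : ℝ) (gr : ℝ → ℝ) (n : ℕ) : ℝ := ∫ s in (-a)..a, gr s * Real.cos (n * π * s / a)

/-- the integral of an odd function over `[-a, a]` vanishes. [folklore] -/
theorem integral_odd_eq_zero {φ : ℝ → ℝ} (hφ : ∀ s, φ (-s) = -φ s) (a : ℝ) :
    ∫ s in (-a)..a, φ s = 0 := by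
  have h1 : ∫ s in (-a)..a, φ (-s) = ∫ s in (-a)..a, φ s := by
    rw [intervalIntegral.integral_comp_neg, neg_neg]
  have h2 : ∫ s in (-a)..a, φ (-s) = -∫ s in (-a)..a, φ s := by
    rw [← intervalIntegral.integral_neg]
    exact intervalIntegral.integral_congr fun s _ ↦ hφ s
  linarith

/-- `cos((k − l)u) = cos(dist(k,l) u)`. [folklore] -/
theorem cos_sub_mul_eq_cos_dist (k l : ℕ) (u : ℝ) :
    Real.cos (((k : ℝ) - l) * u) = Real.cos ((Nat.dist k l : ℝ) * u) := by
  rcases le_total l k with h | h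
  · rw [Nat.dist_eq_sub_of_le_right h, Nat.cast_sub h]
  · rw [Nat.dist_eq_sub_of_le h, Nat.cast_sub h, ← Real.cos_neg]
    congr 1
    ring

/-- **Unwinding one frequency**: for a continuous `2a`-periodic `G` agreeing with the even `gr` on `[-a, a]`,
`∫_{-π}^{π} G(x − (a/π)u) cos(nu) du = (π/a) cos(nπx/a) A_n` (substitute `s = x − (a/π)u`, shift the period,
expand `cos(nπ(x − s)/a)`, the sine moment of the even `gr` vanishes). [folklore] -/
theorem integral_shift_mul_cos (ha : 0 < a) (hGp : Function.Periodic G (2 * a))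
    (hGeq : ∀ s ∈ Icc (-a) a, G s = gr s) (hev : ∀ s, gr (-s) = gr s) (hgrc : Continuous gr)
    (n : ℕ) (x : ℝ) :
    ∫ u in (-π)..π, G (x - a / π * u) * Real.cos (n * u) =
      π / a * (Real.cos (n * π * x / a) * cosMoment a gr n) := by
  have hπ := Real.pi_pos
  have hc : a / π ≠ 0 := by positivity
  set f : ℝ → ℝ := fun s ↦ G s * Real.cos (n * ((x - s) * (π / a))) with hf
  have h1 : (fun u ↦ G (x - a / π * u) * Real.cos (n * u)) = fun u ↦ f (x - a / π * u) := by
    funext u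
    simp only [hf]
    congr 2
    field_simp
    ring
  have h2 : ∫ u in (-π)..π, f (x - a / π * u) =
      (a / π)⁻¹ • ∫ s in (x - a / π * π)..(x - a / π * (-π)), f s :=
    intervalIntegral.integral_comp_sub_mul f hc x
  have h3 : x - a / π * π = x - a := by field_simp
  have h4 : x - a / π * (-π) = x - a + 2 * a := by field_simp; ring
  have hfp : Function.Periodic f (2 * a) := by
    intro s
    simp only [hf]
    rw [hGp, show n * ((x - (s + 2 * a)) * (π / a)) = n * ((x - s) * (π / a)) - n * (2 * π) by
      field_simp; ring, Real.cos_sub_nat_mul_two_pi]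
  have h5 : ∫ s in (x - a)..(x - a + 2 * a), f s = ∫ s in (-a)..(-a + 2 * a), f s :=
    hfp.intervalIntegral_add_eq (x - a) (-a)
  have h6 : (-a + 2 * a) = a := by ring
  have h7 : ∫ s in (-a)..a, f s = ∫ s in (-a)..a, (Real.cos (n * π * x / a) * (gr s * Real.cos (n * π * s / a)) +
      Real.sin (n * π * x / a) * (gr s * Real.sin (n * π * s / a))) := by
    refine intervalIntegral.integral_congr fun s hs ↦ ?_
    rw [Set.uIcc_of_le (by linarith)] at hs
    simp only [hf]
    rw [hGeq s hs, show n * ((x - s) * (π / a)) = n * π * x / a - n * π * s / a by field_simp,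
      Real.cos_sub]
    ring
  have hodd : ∫ s in (-a)..a, gr s * Real.sin (n * π * s / a) = 0 :=
    integral_odd_eq_zero (fun s ↦ by
      rw [hev, show n * π * (-s) / a = -(n * π * s / a) by ring, Real.sin_neg]; ring) a
  have hi1 : IntervalIntegrable (fun s ↦ gr s * Real.cos (n * π * s / a)) volume (-a) a :=
    (hgrc.mul (by fun_prop)).intervalIntegrable _ _
  have hi2 : IntervalIntegrable (fun s ↦ gr s * Real.sin (n * π * s / a)) volume (-a) a :=
    (hgrc.mul (by fun_prop)).intervalIntegrable _ _
  rw [h1, h2, h3, h4, h5, h6, h7, intervalIntegral.integral_add (hi1.const_mul _) (hi2.const_mul _),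
    intervalIntegral.integral_const_mul, intervalIntegral.integral_const_mul, hodd, mul_zero, add_zero,
    smul_eq_mul, inv_div]
  rfl

/-- the factors turning `cos(nπx/a)` into Connes' `ξ_n` for `L = 2a`: `xiScale a n · ξ_n(x) = cos(nπx/a)`.
[folklore] -/
def xiScale (a : ℝ) (n : ℕ) : ℝ :=
  if n = 0 then Real.sqrt (2 * a) else (-1 : ℝ) ^ n / Real.sqrt (2 / (2 * a))

/-- `xiScale a n · ξ_n(x) = cos(nπx/a)` (`L = 2a`). [folklore] -/
theorem xiScale_mul_xiEven (ha : 0 < a) (n : ℕ) (x : ℝ) :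
    xiScale a n * xiEven (2 * a) n x = Real.cos (n * π * x / a) := by
  unfold xiScale xiEven
  split_ifs with h
  · subst h
    have hs : Real.sqrt (2 * a) ≠ 0 := (Real.sqrt_pos.2 (by positivity)).ne'
    rw [Nat.cast_zero, zero_mul, zero_mul, zero_div, Real.cos_zero, mul_one_div_cancel hs]
  · have hq : Real.sqrt (2 / (2 * a)) ≠ 0 := (Real.sqrt_pos.2 (by positivity)).ne'
    have hpow : ((-1 : ℝ) ^ n) * ((-1 : ℝ) ^ n) = 1 := by
      rw [← mul_pow, neg_one_mul, neg_neg, one_pow]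
    rw [show 2 * π * n * x / (2 * a) = n * π * x / a by field_simp]
    calc (-1 : ℝ) ^ n / Real.sqrt (2 / (2 * a)) *
          ((-1 : ℝ) ^ n * Real.sqrt (2 / (2 * a)) * Real.cos (n * π * x / a))
        = ((-1 : ℝ) ^ n * (-1 : ℝ) ^ n) * (Real.sqrt (2 / (2 * a)) / Real.sqrt (2 / (2 * a))) *
            Real.cos (n * π * x / a) := by ring
      _ = Real.cos (n * π * x / a) := by rw [hpow, div_self hq, one_mul, one_mul]

/-- The COEFFICIENTS of the Fejér mean in Connes' basis: `v_n = Σ_{k,l ≤ M, |k−l| = n} A_n e_n/(2a(M+1))`.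
[folklore] -/
def fejerCoeff (a : ℝ) (gr : ℝ → ℝ) (M : ℕ) (n : ℕ) : ℝ :=
  ∑ k ∈ Finset.range (M + 1), ∑ l ∈ Finset.range (M + 1),
    if n = Nat.dist k l then 1 / (2 * a * (M + 1)) * cosMoment a gr n * xiScale a n else 0

/-- the coefficient vector of the `M`-th Fejér mean (a window vector at truncation `M`). [folklore] -/
def fejerVec (a : ℝ) (gr : ℝ → ℝ) (M : ℕ) : Fin (M + 1) → ℝ := fun n ↦ fejerCoeff a gr M n

/-- **The Fejér mean of the even periodisation is a Connes cosine profile on all of `ℝ`**: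
`σ_M = profile (2a) (fejerVec a gr M)`. [folklore] -/
theorem fejerMean_eq_profile (ha : 0 < a) (hGc : Continuous G) (hGp : Function.Periodic G (2 * a))
    (hGeq : ∀ s ∈ Icc (-a) a, G s = gr s) (hev : ∀ s, gr (-s) = gr s) (hgrc : Continuous gr)
    (M : ℕ) (x : ℝ) :
    fejerMean a G M x = profile (2 * a) (fejerVec a gr M) x := by
  have hπ := Real.pi_pos
  have hM : (0 : ℝ) < M + 1 := by positivity
  -- the right-hand side as a double sum over `(k, l)`
  have hR : profile (2 * a) (fejerVec a gr M) x = ∑ k ∈ Finset.range (M + 1), ∑ l ∈ Finset.range (M + 1),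
      1 / (2 * a * (M + 1)) * cosMoment a gr (Nat.dist k l) * Real.cos (Nat.dist k l * π * x / a) := by
    unfold profile fejerVec
    rw [Fin.sum_univ_eq_sum_range (fun n ↦ fejerCoeff a gr M n * xiEven (2 * a) n x) (M + 1)]
    simp only [fejerCoeff, Finset.sum_mul, ite_mul, zero_mul]
    rw [Finset.sum_comm]
    refine Finset.sum_congr rfl fun k hk ↦ ?_
    rw [Finset.sum_comm]
    refine Finset.sum_congr rfl fun l hl ↦ ?_
    rw [Finset.sum_ite_eq' (Finset.range (M + 1)) (Nat.dist k l),
      if_pos (by rw [Finset.mem_range] at hk hl ⊢; unfold Nat.dist; omega),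
      mul_assoc, xiScale_mul_xiEven ha]
  -- the left-hand side
  have hF : ∀ u, fejerKernel (M + 1) u = (∑ k ∈ Finset.range (M + 1), ∑ l ∈ Finset.range (M + 1),
      Real.cos ((Nat.dist k l : ℝ) * u)) / (M + 1) := by
    intro u
    rw [fejerKernel_eq_double_sum_cos]
    simp_rw [cos_sub_mul_eq_cos_dist]
  have hGs : Continuous fun u ↦ G (x - a / π * u) :=
    hGc.comp (continuous_const.sub (continuous_const.mul continuous_id))
  have hi : ∀ k l : ℕ, IntervalIntegrable (fun u ↦ G (x - a / π * u) * Real.cos ((Nat.dist k l : ℝ) * u))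
      volume (-π) π := fun k l ↦
    (hGs.mul (Real.continuous_cos.comp (continuous_const.mul continuous_id))).intervalIntegrable _ _
  have hirow : ∀ k : ℕ, IntervalIntegrable (fun u ↦ ∑ l ∈ Finset.range (M + 1),
      G (x - a / π * u) * Real.cos ((Nat.dist k l : ℝ) * u)) volume (-π) π := fun k ↦
    (continuous_finsetSum _ fun l _ ↦
      hGs.mul (Real.continuous_cos.comp (continuous_const.mul continuous_id))).intervalIntegrable _ _
  have e1 : (fun u ↦ G (x - a / π * u) * fejerKernel (M + 1) u) = fun u ↦ (∑ k ∈ Finset.range (M + 1),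
      ∑ l ∈ Finset.range (M + 1), G (x - a / π * u) * Real.cos ((Nat.dist k l : ℝ) * u)) / (M + 1) := by
    funext u
    rw [hF u, mul_div_assoc', Finset.mul_sum]
    congr 1
    exact Finset.sum_congr rfl fun k _ ↦ Finset.mul_sum _ _ _
  have hL : ∫ u in (-π)..π, G (x - a / π * u) * fejerKernel (M + 1) u =
      (∑ k ∈ Finset.range (M + 1), ∑ l ∈ Finset.range (M + 1),
        π / a * (Real.cos (Nat.dist k l * π * x / a) * cosMoment a gr (Nat.dist k l))) / (M + 1) := by
    rw [e1, intervalIntegral.integral_div, intervalIntegral.integral_finsetSum fun k _ ↦ hirow k]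
    congr 1
    refine Finset.sum_congr rfl fun k _ ↦ ?_
    rw [intervalIntegral.integral_finsetSum fun l _ ↦ hi k l]
    exact Finset.sum_congr rfl fun l _ ↦ integral_shift_mul_cos ha hGp hGeq hev hgrc _ x
  rw [hR, fejerMean, hL, mul_div_assoc', Finset.mul_sum, Finset.sum_div]
  refine Finset.sum_congr rfl fun k _ ↦ ?_
  rw [Finset.mul_sum, Finset.sum_div]
  refine Finset.sum_congr rfl fun l _ ↦ ?_
  field_simp

end FejerProfile

end Summit.RiemannHypothesis.RiemannHypothesis.Theorems.PfPersistence
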